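import Summits.ResolutionOfSingularities.ResolutionOfSingularities.Theorems.FrobeniusClosingPatchingRelPerfectDepthFlagTargets
import Summits.ResolutionOfSingularities.ResolutionOfSingularities.Theorems.FrobeniusClosingPatchingRelPerfectDepthOneBlowupDimension
import Summits.ResolutionOfSingularities.ResolutionOfSingularities.Theorems.FrobeniusClosingPatchingRelPerfectDepthWeightedSeqJBookkeeping
import Literature.AlgebraicGeometry.Resolution.BlowupsIntegral
import Literature.AlgebraicGeometry.Resolution.NormalCrossingsStrictification
import Literature.AlgebraicGeometry.Resolution.RegularBlowup
import Literature.AlgebraicGeometry.Resolution.ExcellentBlowup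
import Literature.AlgebraicGeometry.Resolution.RegularCentreBlowupSeqIntegral
import Literature.AlgebraicGeometry.Resolution.ArithmeticalThreefoldsBlowupFormDimThree
import Literature.AlgebraicGeometry.Resolution.Principalization
import Literature.AlgebraicGeometry.Resolution.CartierDivisorControlledTransform
import Literature.AlgebraicGeometry.Resolution.NonPrincipalLocus
import Literature.AlgebraicGeometry.Resolution.ProjectiveSpaceExcellent
import HarnessLib

/-!
# Crux `PatchingRelPerfect` (stmt-ResolutionOfSingularities-16161), chain W5.2 — F6 stage 1 («flag order reduction»)
# Bookkeeping FEEDER: the output clauses `FlagState₃` are transported along every `IsFlagSeq`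

[OURS · L1 W5.2 · F6 · TargetsF6 v1.1 7001d3757fbb0aa3 · res-L1-w52-plan-1 g8 OFFER 09:59:52Z «pv-021 — OFFERED NOW
`…DepthFlagSeqBookkeeping.lean` (`IsFlagSeq.flagState₃ …`)»; STEER 2 10:04:06Z (iii) (B3)]  Pure PROOFS, no definitions, no named
facts.  `DepthTargets.FlagState₃ E' 𝔟' R₁'` (integral · Noetherian · regular · excellent · `dim = 3` · `𝔟' ≠ ⊥` · `𝔟'` locally
principal · `𝔟' ≤ R₁'`) holds at the END of any `IsFlagSeq ρ 𝔟 R₁ 𝔟' R₁'` if it holds at the start: each `cons` blows up a regular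
centre `C` with `𝔟' ≤ C²` (so `C ≠ ⊥`, nowhere dense on the integral `E'`), and every clause is a tree brick —
`IsBlowup.isIntegral`, `isNoetherian_of_isBlowup`, `IsBlowup.isRegular_of_isRegular_subscheme`, `IsBlowup.isExcellent` (EGA IV 7.8.3),
`DepthOne.topologicalKrullDim_eq_of_isBlowup`, `IsBlowup.comap_ne_bot` + `comap_le_controlledTransform`, res-D-pv-026's (L-A)
`IsBlowup.isEffectiveCartier_controlledTransform_of_le_pow` (+ `IsLocallyPrincipal.isEffectiveCartier_of_ne_bot`,
`IsEffectiveCartier.isLocallyPrincipal`), and `le_sup_left` for the flag clause.  Consumers: the holders of `StageOnePrephase₃`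
(res-type-049) / `StageOneFlagScoped₃` (idea-1's closer) and the composition `stageOneFlag₃_of_prephase_of_scoped`.
AI-written; AI review is weaker than expert review. Nothing here is a statement of the manuscript under review.

## References
* J. Kollár, *Lectures on Resolution of Singularities* (2007), 3.30.2. [Kollar2007]
* E. Bierstone, D. Grigoriev, P. Milman, J. Włodarczyk (2011), §3.2 Lemma 3.2.1. [BierstoneGrigorievMilmanWlodarczyk2011]
-/

-- `Summit.<Summit>.<Sub>.Theorems` with `Sub = Summit` (single-conjunct summit, D-0017)
set_option linter.dupNamespace false

noncomputable section

open CategoryTheory CategoryTheory.Limits AlgebraicGeometry TopologicalSpace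
open Literature.AlgebraicGeometry.Resolution
open Scheme.IdealSheafData

namespace Summit.ResolutionOfSingularities.ResolutionOfSingularities.Theorems.DepthTargets

universe u

/-- One flag step: the centre is non-zero (`𝔟' ≠ ⊥`, `𝔟' ≤ C²`). [folklore] -/
theorem ne_bot_of_le_sq_of_ne_bot {E : Scheme.{u}} {𝔟 C : E.IdealSheafData} (hne : 𝔟 ≠ ⊥) (hle : 𝔟 ≤ C ^ 2) : C ≠ ⊥ := by
  rintro rfl
  apply hne
  rw [← Scheme.IdealSheafData.zero_eq_bot, zero_pow (by norm_num), Scheme.IdealSheafData.zero_eq_bot] at hle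
  exact le_bot_iff.mp hle

/-- **`FlagState₃` is transported along an `IsFlagSeq`** (every clause is routine under the blowing up of a regular
flag-permissible centre of an integral Noetherian regular excellent threefold: `IsBlowup.isIntegral`, `isNoetherian_of_isBlowup`,
`IsBlowup.isRegular_of_isRegular_subscheme`, `IsBlowup.isExcellent` (EGA IV 7.8.3 (ii), tree), `DepthOne.topologicalKrullDim_eq_of_isBlowup`,
`IsBlowup.comap_ne_bot` + `comap_le_controlledTransform`, (L-A) `IsBlowup.isEffectiveCartier_controlledTransform_of_le_pow`,
`IsFlagSeq.le`). [cite: Kollar2007, 3.30.2] [cite: BierstoneGrigorievMilmanWlodarczyk2011, §3.2] -/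
theorem IsFlagSeq.flagState₃ :
    ∀ {E' E : Scheme.{u}} {ρ : E' ⟶ E} {𝔟 R₁ : E.IdealSheafData} {𝔟' R₁' : E'.IdealSheafData},
      IsFlagSeq ρ 𝔟 R₁ 𝔟' R₁' → FlagState₃ E 𝔟 R₁ → FlagState₃ E' 𝔟' R₁'
  | _, _, _, _, _, _, _, .nil 𝔟 R₁, h => h
  | _, _, _, _, _, _, _, .cons τ ρ 𝔟 R₁ 𝔟' R₁' C h hC hle hR hτ, h0 => by
    obtain ⟨hint, hnoeth, hreg, hexc, hdim, hne, hlp, hleR⟩ := h.flagState₃ h0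
    haveI := hint
    haveI := hnoeth
    have hC0 : C ≠ ⊥ := ne_bot_of_le_sq_of_ne_bot hne hle
    have hCsupp : C.support ≠ ⊤ := fun htop =>
      not_mem_support_genericPoint hC0 (by rw [htop]; trivial)
    have hcart : IsEffectiveCartier 𝔟' := hlp.isEffectiveCartier_of_ne_bot hne
    refine ⟨hτ.isIntegral hC0, isNoetherian_of_isBlowup hτ, hτ.isRegular_of_isRegular_subscheme hreg hC,
      hτ.isExcellent hexc, DepthOne.topologicalKrullDim_eq_of_isBlowup hτ hC0 hdim, ?_, ?_, le_sup_left⟩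
    · exact fun h0' => hτ.comap_ne_bot hCsupp hne
        (le_bot_iff.mp ((comap_le_controlledTransform τ C 𝔟' 2).trans h0'.le))
    · exact (hτ.isEffectiveCartier_controlledTransform_of_le_pow hcart hle).isLocallyPrincipal

section Clauses

variable {E' E : Scheme.{u}} {ρ : E' ⟶ E} {𝔟 R₁ : E.IdealSheafData} {𝔟' R₁' : E'.IdealSheafData}
  (h : IsFlagSeq ρ 𝔟 R₁ 𝔟' R₁') (h0 : FlagState₃ E 𝔟 R₁)
include h h0

/-- Clause: the top is integral. [folklore] -/
theorem IsFlagSeq.isIntegral : IsIntegral E' := (h.flagState₃ h0).1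
/-- Clause: the top is Noetherian. [folklore] -/
theorem IsFlagSeq.isNoetherian : IsNoetherian E' := (h.flagState₃ h0).2.1
/-- Clause: the top is regular. [folklore] -/
theorem IsFlagSeq.isRegular : Scheme.IsRegular E' := (h.flagState₃ h0).2.2.1
/-- Clause: the top is excellent (EGA IV 7.8.3 (ii), tree `IsBlowup.isExcellent`). [folklore] -/
theorem IsFlagSeq.isExcellent : Scheme.IsExcellent E' := (h.flagState₃ h0).2.2.2.1
/-- Clause: the top has dimension three. [folklore] -/
theorem IsFlagSeq.topologicalKrullDim_eq : topologicalKrullDim E' = 3 := (h.flagState₃ h0).2.2.2.2.1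
/-- Clause: the transported `𝔟'` is non-zero. [folklore] -/
theorem IsFlagSeq.ne_bot : 𝔟' ≠ ⊥ := (h.flagState₃ h0).2.2.2.2.2.1
/-- Clause: the transported `𝔟'` is locally principal. [folklore] -/
theorem IsFlagSeq.isLocallyPrincipal : IsLocallyPrincipal 𝔟' := (h.flagState₃ h0).2.2.2.2.2.2.1

end Clauses

/-- **The initial `FlagState₃` on `E = ℙ³_K`** (the member class of F6: `𝔟 = (f̄)` non-zero locally principal, `𝔟 ≤ R₁ = (f̄, ḡ)`),
from the tree's standing package `projSpace_standing` (integral · Noetherian · regular · excellent · `dim = 3`).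
[cite: StacksProject, Tag 07QW] -/
theorem flagState₃_projSpace (K : Type u) [Field K] {𝔟 R₁ : (Literature.AlgebraicGeometry.Motives.ProjSpace.P 3 K).IdealSheafData}
    (hne : 𝔟 ≠ ⊥) (hlp : IsLocallyPrincipal 𝔟) (hle : 𝔟 ≤ R₁) :
    FlagState₃ (Literature.AlgebraicGeometry.Motives.ProjSpace.P 3 K) 𝔟 R₁ := by
  obtain ⟨h1, h2, h3, h4, h5⟩ := ProjectiveSpace.projSpace_standing 3 K
  exact ⟨h1, h2, h3, h4, by exact_mod_cast h5, hne, hlp, hle⟩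

end Summit.ResolutionOfSingularities.ResolutionOfSingularities.Theorems.DepthTargets

end
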